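import Summits.BirchSwinnertonDyer.BirchSwinnertonDyer.Theorems.CyclotomicUntwistPSLocalThreeTorsionIIShape
import Summits.BirchSwinnertonDyer.BirchSwinnertonDyer.Theorems.CyclotomicUntwistPSKrausC6Parity
import HarnessLib

/-!
# LAW L-t3 on the Kodaira-`II` rows (`v₃Δ_min = 4`): `W(ℚ₃)[3] ≠ 0 ⟺ c₆(W_ℤ)/3³ ≡ 1 (mod 3)` —
# the last of the four cyclic wild rows at `3` of route `CyclotomicUntwist`

Cell `pub/bsd-wall` (D-0145 line `route-BirchSwinnertonDyer-CyclotomicUntwist`), seat `bsd-line-cycu-p2`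
(prover seat 2/3, gen 3), helper toward K1 `PSRankOneLowerHalfAtThree` (stmt-BirchSwinnertonDyer-21580)
and K2 `PSRankOneUpperHalfAtThree` (stmt-21581): the local condition at `3` of a `3`-descent on the
principal-series rows. THEOREMS ONLY (no definition, no named fact, no `sorry`); BSD is not proved by
this file and no crux is.

With this file the `ℚ₃`-rational `3`-torsion is decided on ALL FOUR rows of the cyclic wild cell
(`ClassO6 W 3`, `v = v₃Δ_min` even) in Kraus-invariant currency:
* `v = 4` (`II`, `v₃c₆ = 3`): `W(ℚ₃)[3] ≠ 0 ⟺ c₆/3³ ≡ 1 (mod 3)` — THIS FILE;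
* `v = 6` (`IV`, `v₃c₆ = 5`): `⟺ c₆/3⁵ ≡ 1 (mod 3) ⟺ c₃ = 3` (`…PSLocalThreeTorsionEt.lean`);
* `v = 10, 12` (`IV*`, `II*`): never (`…PSLocalThreeTorsionStar.lean`);
assembled below as `not_noLocalThreeTorsionAt_three_iff_of_psRow`:
`W(ℚ₃)[3] ≠ 0 ⟺ v ≤ 6 ∧ c₆/3^{v₃c₆} ≡ 1 (mod 3)`.

## Method
The `II` rows are a one-stable-line locus (`exists_isUniqueStableLineThree_of_kodairaII`: uniqueness from
Tate's normal form over `K_v`, existence from the V10 Newton polygon — both in part 1,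
`…PSLocalThreeTorsionIIShape.lean`; the inputs `v₃c₆ = 3` (`PSTamagawaThree.padicValInt_c₆_eq_three_of_kodairaII`)
and `v₃c₄ ≥ 2` (the c-relation)). Then V10's `stableLineSignThree_eq_c₆_mul` and
`isSquare_intCast_padic_three_iff` read the sign of the stable line: `−216·c₆ = 3⁶·(−8·c₆/3³)` is a square
in `ℚ₃` iff `c₆/3³ ≡ 1 (mod 3)`. Numerics (this seat, `census/lt3_check.py`, exact 3-adic root isolation):
424 of the 808 curves with `81 ∥ N < 3·10⁴`, `K₃ = II`, `v = 4` have `E(ℚ₃)[3] ≠ 0`, exactly those with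
`c₆/27 ≡ 1 (mod 3)` — EVIDENCE only.
References: J. H. Silverman, *Advanced Topics* (1994), IV.9.4 Step 3 [SilvermanATAEC1994]; J.-P. Serre,
Invent. Math. 15 (1972), §1.11 [Serre1972]; A. Kraus, Manuscripta Math. 69 (1990), Théorème (p = 3) [Kraus1990].
-/

set_option autoImplicit false
-- single-conjunct summit: `Summit.BirchSwinnertonDyer.BirchSwinnertonDyer.…` repeats the name by design
set_option linter.dupNamespace false

noncomputable section

open scoped Classical

open Polynomial WeierstrassCurve IsDedekindDomain IsDedekindDomain.HeightOneSpectrum WithZero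
  Rat.HeightOneSpectrum Literature.NumberTheory.EllipticCurves
  Literature.NumberTheory.EllipticCurves.Rank1Residual Literature.NumberTheory.DiophantineGeometry
  Summit.BirchSwinnertonDyer.Rank1Residual.Additive Summit.BirchSwinnertonDyer.Rank1Residual.O5
  Summit.BirchSwinnertonDyer.Rank1Residual.O5.NonSplitAtThree
  Summit.BirchSwinnertonDyer.Rank1Residual.Additive.PsiThreeAdic
  Summit.BirchSwinnertonDyer.Rank1Residual.GaloisImage.LocalTorsion3

open Summit.BirchSwinnertonDyer.Rank1Residual.Additive.ThreeAdicLift (le_exp_sub_one_of_lt_exp)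

namespace Summit.BirchSwinnertonDyer.BirchSwinnertonDyer.Theorems.PSLocalThreeTorsion

/-! ## The Kodaira-`II` rows (`v₃Δ_min = 4`) and the PS-row summary -/

section Curves

variable (W : WeierstrassCurve ℚ) [W.IsElliptic] [W.IsGloballyMinimal]

/-- `v₃ c₆(W) = 3` on the Kodaira-`II` rows with `v₃Δ_min = 4`, in `padicValRat` currency. [cite: Kraus1990, Théorème (p = 3)] -/
theorem padicValRat_c₆_eq_three_of_kodairaII (hK : W.kodairaSymbolAt (placeOf 3) = .II)
    (hv : padicValInt 3 W.minimalDiscriminantInt = 4) : padicValRat 3 W.c₆ = 3 := by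
  rw [← cast_integralModelInt_c₆, padicValRat.of_int]
  exact_mod_cast PSTamagawaThree.padicValInt_c₆_eq_three_of_kodairaII W hK hv

/-- `c₄ ≠ 0`, `c₆ ≠ 0` and `v₃ c₄ ≥ 2` on the Kodaira-`II` rows with `v₃Δ_min = 4` (`c₄³ = c₆² + 1728Δ`:
valuations `6` and `7` on the right). [cite: SilvermanAEC2009, III.1 (c-relation)] -/
theorem c₄_c₆_of_kodairaII (hK : W.kodairaSymbolAt (placeOf 3) = .II)
    (hv : padicValInt 3 W.minimalDiscriminantInt = 4) :
    W.c₄ ≠ 0 ∧ W.c₆ ≠ 0 ∧ 2 ≤ padicValRat 3 W.c₄ := by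
  have hv3 := padicValRat_c₆_eq_three_of_kodairaII W hK hv
  have h₆ : W.c₆ ≠ 0 := by
    intro h0
    have h5 := PSTamagawaThree.padicValInt_c₆_eq_three_of_kodairaII W hK hv
    have hz : (integralModelInt W).c₆ = 0 := by
      have := cast_integralModelInt_c₆ W
      rw [h0] at this
      exact_mod_cast this
    rw [hz] at h5
    simp at h5
  have hΔ : W.Δ ≠ 0 := W.coe_Δ' ▸ W.Δ'.ne_zero
  have hvΔ : padicValRat 3 W.Δ = 4 := by
    rw [← cast_minimalDiscriminantInt, padicValRat.of_int]; exact_mod_cast hv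
  have h1728 : padicValRat 3 (1728 : ℚ) = 3 := by
    have h := padicValRat_three_pow_mul 3 64 (by norm_num)
    norm_num at h
    exact_mod_cast h
  have hrel : W.c₄ ^ 3 = W.c₆ ^ 2 + 1728 * W.Δ := by linear_combination -W.c_relation
  have hv1 : padicValRat 3 (W.c₆ ^ 2) = 6 := by rw [padicValRat.pow, hv3]; norm_num
  have hv2 : padicValRat 3 (1728 * W.Δ) = 7 := by
    rw [padicValRat.mul (by norm_num) hΔ, h1728, hvΔ]; norm_num
  have hsum : W.c₆ ^ 2 + 1728 * W.Δ ≠ 0 := by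
    intro h0
    have e : W.c₆ ^ 2 = -(1728 * W.Δ) := by linear_combination h0
    have := congrArg (padicValRat 3) e
    rw [padicValRat.neg, hv1, hv2] at this
    norm_num at this
  have h₄ : W.c₄ ≠ 0 := by
    intro h0
    rw [h0, zero_pow three_ne_zero] at hrel
    exact hsum hrel.symm
  refine ⟨h₄, h₆, ?_⟩
  have hmin := padicValRat.min_le_padicValRat_add (p := 3) hsum
  rw [hv1, hv2, ← hrel, padicValRat.pow] at hmin
  norm_num at hmin
  omega

/-- **The Kodaira-`II` rows (`v₃Δ_min = 4`) are a one-stable-line locus**: `Ψ₃` has exactly one root in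
`ℚ₃` (existence: V10 Newton polygon on the short model; uniqueness: §2 on Tate's normal form).
[cite: SilvermanATAEC1994, IV.9.4 Step 3] [cite: Serre1972, §1.11] -/
theorem exists_isUniqueStableLineThree_of_kodairaII (hK : W.kodairaSymbolAt (placeOf 3) = .II)
    (hv : padicValInt 3 W.minimalDiscriminantInt = 4) : ∃ x₀, IsUniqueStableLineThree W x₀ := by
  obtain ⟨h₄, h₆, h2⟩ := c₄_c₆_of_kodairaII W hK hv
  have hv3 := padicValRat_c₆_eq_three_of_kodairaII W hK hv
  have hord : W.ordMinimalDiscriminant (placeOf 3) = 4 := by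
    rw [ordMinimalDiscriminant_placeOf_eq W 3, hv]
  obtain ⟨x, hx⟩ := exists_isRoot_Ψ₃_padic_of_le W h₄ h₆ (by rw [hv3]; omega)
  exact ⟨x, hx, fun r hr ↦ Ψ₃_root_unique_padic_of_kodairaII W hK hord r x hr hx⟩

/-- **LAW L-t3 on the `II` rows: `W(ℚ₃)[3] ≠ 0 ⟺ c₆(W_ℤ)/3³ ≡ 1 (mod 3)`** (`K₃ = II`, `v₃Δ_min = 4`).
The sign of the unique stable line is `(−1/216)·c₆·w` with `w` a principal unit, a square in `ℚ₃` iff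
`−216·c₆ = 3⁶·(−8·c₆/3³)` is, iff `c₆/3³ ≡ 1 (mod 3)`. [cite: Serre1972, §1.11] [cite: Serre1973, Ch. II §3.3] -/
theorem not_noLocalThreeTorsionAt_three_iff_c₆_of_kodairaII (hK : W.kodairaSymbolAt (placeOf 3) = .II)
    (hv : padicValInt 3 W.minimalDiscriminantInt = 4) :
    ¬ NoLocalThreeTorsionAt W 3 ↔ (integralModelInt W).c₆ / 3 ^ 3 % 3 = 1 := by
  obtain ⟨x₀, hx⟩ := exists_isUniqueStableLineThree_of_kodairaII W hK hv
  have h5 := PSTamagawaThree.padicValInt_c₆_eq_three_of_kodairaII W hK hv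
  obtain ⟨hc₆, w, hw, hF⟩ := stableLineSignThree_eq_c₆_mul W hx
  -- (1) `W(ℚ₃)[3] ≠ 0 ⟺` the sign is a square
  have step1 : ¬ NoLocalThreeTorsionAt W 3 ↔ IsSquare (stableLineSignThree W x₀) := by
    rw [not_noLocalThreeTorsionAt_iff_exists]
    constructor
    · rintro ⟨x, s, hr, hs⟩
      rw [hx.2 x hr] at hs
      exact ⟨s, by rw [← sq]; exact hs⟩
    · rintro ⟨s, hs⟩
      exact ⟨x₀, s, hx.1, by rw [sq]; exact hs⟩
  -- (2) `⟺ (−1/216)·c₆` is a square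
  have hc0 : (-1 / 216 : ℚ_[3]) * (W.c₆ : ℚ_[3]) ≠ 0 :=
    mul_ne_zero (by norm_num) (by exact_mod_cast hc₆)
  have step2 : IsSquare (stableLineSignThree W x₀) ↔ IsSquare ((-1 / 216 : ℚ_[3]) * (W.c₆ : ℚ_[3])) := by
    refine (isSquare_iff_of_norm_sub_le hc0 ?_).2
    rw [hF, show (-1 / 216 : ℚ_[3]) * (W.c₆ : ℚ_[3]) * w - -1 / 216 * (W.c₆ : ℚ_[3]) =
      (-1 / 216 * (W.c₆ : ℚ_[3])) * (w - 1) by ring, norm_mul, mul_comm]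
    have hw' : ‖w - 1‖ ≤ 3⁻¹ := by
      have := (Padic.norm_le_pow_iff_norm_lt_pow_add_one (w - 1) (-1)).mpr (by simpa using hw)
      simpa using this
    exact mul_le_mul_of_nonneg_right hw' (norm_nonneg _)
  -- (3) `⟺ −216·c₆(W_ℤ)` is a square (rescale by the square `216²`)
  set n : ℤ := (integralModelInt W).c₆ with hn
  have hcast : (W.c₆ : ℚ_[3]) = ((n : ℚ) : ℚ_[3]) := by rw [hn, cast_integralModelInt_c₆]
  have step3 : IsSquare ((-1 / 216 : ℚ_[3]) * (W.c₆ : ℚ_[3])) ↔ IsSquare (((-216 * n : ℤ) : ℚ) : ℚ_[3]) := by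
    have e : (((-216 * n : ℤ) : ℚ) : ℚ_[3]) = ((-1 / 216 : ℚ_[3]) * (W.c₆ : ℚ_[3])) * (216 * 216) := by
      rw [hcast]; push_cast; ring
    rw [e]
    constructor
    · rintro ⟨r, hr⟩; exact ⟨r * 216, by rw [hr]; ring⟩
    · rintro ⟨r, hr⟩
      refine ⟨r / 216, ?_⟩
      have h216 : (216 : ℚ_[3]) ≠ 0 := by norm_num
      field_simp
      linear_combination hr
  -- (4) the integer square class: `−216·n = 3⁶·(−8m)`, `m = n/3³`, `3 ∤ m`
  have hdvd : (3 : ℤ) ^ 3 ∣ n := by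
    have := padicValInt_dvd (p := 3) n
    rw [h5] at this; exact_mod_cast this
  obtain ⟨m, hm⟩ := hdvd
  have hm3 : ¬ (3 : ℤ) ∣ m := by
    rintro ⟨k, rfl⟩
    have h6 : ((3 : ℕ) : ℤ) ^ 4 ∣ n := ⟨k, by rw [hm]; ring⟩
    have hn0 : n ≠ 0 := by
      intro h0; rw [h0] at h5; simp at h5
    have := (padicValInt_dvd_iff 4 n).mp h6
    rw [h5] at this
    omega
  have hdiv : n / 3 ^ 3 = m := by rw [hm, Int.mul_ediv_cancel_left _ (by norm_num)]
  have h8 : (3 : ℤ) ^ 6 ∣ -216 * n := ⟨-8 * m, by rw [hm]; ring⟩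
  have h9 : ¬ (3 : ℤ) ^ 7 ∣ -216 * n := by
    rintro ⟨k, hk⟩
    apply hm3
    refine ⟨k + 3 * m, ?_⟩
    have e : (3 : ℤ) ^ 6 * (-8 * m) = (3 : ℤ) ^ 6 * (3 * k) := by
      rw [hm] at hk; linear_combination hk
    have e' := mul_left_cancel₀ (pow_ne_zero 6 (by norm_num : (3 : ℤ) ≠ 0)) e
    linarith
  have step4 := isSquare_intCast_padic_three_iff (-216 * n) 6 h8 h9
  have hq : (((-216 * n : ℤ) : ℚ) : ℚ_[3]) = ((-216 * n : ℤ) : ℚ_[3]) := by push_cast; ring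
  rw [step1, step2, step3, hq, step4, hdiv,
    show -216 * n / 3 ^ 6 = -8 * m by rw [hm, show (-216 : ℤ) * (3 ^ 3 * m) = 3 ^ 6 * (-8 * m) by ring,
      Int.mul_ediv_cancel_left _ (by norm_num)]]
  omega

/-- **Point reading on the `II` rows**: `W(ℚ₃)` has a point of order `3` iff `c₆(W_ℤ)/3³ % 3 = 1`
(`K₃ = II`, `v₃Δ_min = 4`). [cite: Serre1972, §1.11] [cite: SilvermanATAEC1994, IV.9.4 Step 3] -/
theorem exists_three_torsion_iff_c₆_of_kodairaII (hK : W.kodairaSymbolAt (placeOf 3) = .II)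
    (hv : padicValInt 3 W.minimalDiscriminantInt = 4) :
    (∃ P : (W.baseChange ℚ_[3]).toAffine.Point, P ≠ 0 ∧ 3 • P = 0) ↔
      (integralModelInt W).c₆ / 3 ^ 3 % 3 = 1 := by
  rw [exists_ne_zero_three_nsmul_iff_not_noLocalThreeTorsionAt W 3,
    not_noLocalThreeTorsionAt_three_iff_c₆_of_kodairaII W hK hv]

/-- **Census spelling**: on the wild cell (`ClassO6 W 3`) with `v₃Δ_min = 4` (then Kodaira `II`,
`PSKodairaDictionary.kodairaSymbolAt_of_four_dvd`): `W(ℚ₃)[3] ≠ 0 ⟺ c₆(W_ℤ)/3³ % 3 = 1`, although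
`c₃ = 1` there (`PSKodairaDictionary.localTamagawaNumber_three_eq_one_of_four_dvd`) — the O6 law
"`E(ℚ_q)[3] ≠ 0 ⟺ c_q = 3`" of the tree (`q ≠ 3`) FAILS at `q = 3` on the `II` rows as on the `IV*` rows.
[cite: SilvermanATAEC1994, IV.9.4 Step 3] [cite: Kraus1990, Théorème (p = 3)] -/
theorem not_noLocalThreeTorsionAt_three_iff_of_classO6_of_four (hO6 : ClassO6 W 3)
    (h4 : padicValInt 3 W.minimalDiscriminantInt = 4) :
    ¬ NoLocalThreeTorsionAt W 3 ↔ (integralModelInt W).c₆ / 3 ^ 3 % 3 = 1 := by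
  obtain ⟨-, hadd, hW⟩ := hO6
  rcases PSKodairaDictionary.kodairaSymbolAt_of_four_dvd W hadd hW ⟨1, by omega⟩ with ⟨hK, -⟩ | ⟨-, h⟩
  · exact not_noLocalThreeTorsionAt_three_iff_c₆_of_kodairaII W hK h4
  · omega

/-- **LAW L-t3 on ALL principal-series rows of the route** (`ClassO6 W 3`, `v = v₃Δ_min` even, so
`(v, v₃c₆) ∈ {(4,3), (6,5), (10,6), (12,8)}` by `PSTamagawaThree.padicValInt_c₆_of_classO6_of_even`):
`W(ℚ₃)[3] ≠ 0 ⟺ v ≤ 6 ∧ c₆(W_ℤ)/3^{v₃c₆} ≡ 1 (mod 3)` — rows `II` (this file), `IV`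
(`not_noLocalThreeTorsionAt_three_iff_c₆_of_kodairaIV`), `IV*`/`II*` (never:
`noLocalThreeTorsionAt_three_of_classO6_of_ten_or_twelve`). Compare LAW L-c3
(`PSTamagawaThree.three_dvd_localTamagawaNumber_three_iff_of_psRow`: `3 ∣ c₃ ⟺ v ≡ 2 (mod 4) ∧ …`): the two
local conditions at `3` agree exactly on the `IV` rows. [cite: SilvermanATAEC1994, IV.9.4 and Table 4.1] [cite: Serre1972, §1.11] -/
theorem not_noLocalThreeTorsionAt_three_iff_of_psRow (hO6 : ClassO6 W 3)
    (hev : Even (padicValInt 3 W.minimalDiscriminantInt)) :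
    ¬ NoLocalThreeTorsionAt W 3 ↔ padicValInt 3 W.minimalDiscriminantInt ≤ 6 ∧
      (integralModelInt W).c₆ / 3 ^ padicValInt 3 (integralModelInt W).c₆ % 3 = 1 := by
  rcases PSTamagawaThree.padicValInt_c₆_of_classO6_of_even W hO6 hev with
    ⟨h, h'⟩ | ⟨h, h'⟩ | ⟨h, h'⟩ | ⟨h, h'⟩
  · rw [not_noLocalThreeTorsionAt_three_iff_of_classO6_of_four W hO6 h, h, h']
    omega
  · obtain ⟨-, hadd, hW⟩ := hO6
    rcases PSKodairaDictionary.kodairaSymbolAt_of_mod_four_eq_two W hadd hW (by omega) with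
      ⟨hK, -⟩ | ⟨-, h10⟩
    · rw [not_noLocalThreeTorsionAt_three_iff_c₆_of_kodairaIV W hK h, h, h']
      omega
    · omega
  · rw [h, h']
    have := noLocalThreeTorsionAt_three_of_classO6_of_ten_or_twelve W hO6 (Or.inl h)
    constructor
    · intro hn; exact absurd this hn
    · rintro ⟨hle, -⟩; omega
  · rw [h, h']
    have := noLocalThreeTorsionAt_three_of_classO6_of_ten_or_twelve W hO6 (Or.inr h)
    constructor
    · intro hn; exact absurd this hn
    · rintro ⟨hle, -⟩; omega

end Curves

end Summit.BirchSwinnertonDyer.BirchSwinnertonDyer.Theorems.PSLocalThreeTorsion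

end
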